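import Summits.CriticalPhenomena.PercolationContinuityZ3.Theorems.PercAnnulusCrossingIICTargetSchemeHypotheses
import Literature.Analysis.Convexity.KestenRatioScheme
import HarnessLib

/-!
# Kesten–Basu–Sapozhnikov IIC scheme in boxes with a GENERAL CONDITIONING TARGET, XVII″: the oscillation bound (lane RSW3, p1 gen 4)

builds on p205010 (kernel theorem, internal audit signed; external expert review pending)

Seat `prim-rsw3-p1` (gen 4).  Part XVII′ (`PercAnnulusCrossingIICAspectScheme.lean`, general aspect `σ, τ`) with the two level vectors
`U = γ_{W,T}`, `U' = γ_{W',T'}` of two GENERAL conditioning targets (Basu–Sapozhnikov Remark 2.1): `CONN(D;W,T) = {R ↔ T in W ∖ U}`,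
both ADMISSIBLE at the reference scale `n` (`τ (M2 l) + 1 ≤ n`): `Λ(n) ⊆ W`, `T ⊆ W ∖ Λ(n−1)`, and every site of `∂ⁱⁿΛ(n)` joined to `T` by a
lattice walk inside `W ∖ Λ(n−1)`.  The index sets are those of the reference box target `n` (parts XIV″/XVI″).  Helper file; no definitions,
no sorries.
* **`conn_ratio_osc_le_target`** — `γ_{W,T}(C) γ_{W',T'}(C') ≤ Q L · γ_{W,T}(C') γ_{W',T'}(C)` for top-level data `C, C'` (with `γ_n > 0`,
  `P(DAT_L) > 0`) and every solution `Q` of Kesten's recursion with `K = ϰ⁻²`.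
References: H. Kesten, PTRF 73 (1986) §2 (22)–(25); D. Basu, A. Sapozhnikov, ECP 22 (2017) no. 26, §2 and Remark 2.1.
-/

noncomputable section

namespace Summit.CriticalPhenomena.PercolationContinuityZ3.Theorems.Crossing

open MeasureTheory Literature.Probability.Percolation Literature.Probability.LatticeModels
open Literature.Probability.Percolation.DCT16
open Summit.CriticalPhenomena.PercolationContinuityZ3.Theorems.SurfaceTension
open scoped Literature.Probability.Percolation
open Literature.Analysis.Convexity.Doeblin

variable {d : ℕ}

/-- **Kesten's scheme for the IIC in boxes, general aspect, two general conditioning targets: the oscillation bound.**  See the module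
docstring for the data; hypotheses: `0 < p`, `0 < ϰ ≤ 1`, (A2)□(ϰ; σ, τ), `1 ≤ L`, the scale hypotheses, junk `≤ ϰ² ε`, `0 ≤ ε < 1`, `Q` a
solution of Kesten's recursion with `K = 1/ϰ²`, and two targets `(W,T)`, `(W',T')` admissible at the reference scale `n`. [cite: Kesten1986, §2 (22)–(25)] [cite: BasuSapozhnikov2017ECP, Thm. 1.1] -/
theorem conn_ratio_osc_le_target (p : unitInterval) (hp : 0 < (p : ℝ)) {ϰ ε : ℝ} (hϰ : 0 < ϰ) (hϰ1 : ϰ ≤ 1)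
    {σ τ : ℕ → ℕ} (hσ : ∀ m : ℕ, 1 ≤ m → m < σ m) (hστ : ∀ m : ℕ, 1 ≤ m → σ m < τ m)
    (hσm : Monotone σ) (hτm : Monotone τ)
    (hA2 : ∀ m : ℕ, 1 ≤ m → ∀ Z : Finset (Site d), box d (τ m) \ box d (m - 1) ⊆ Z →
      ∀ X : Finset (Site d), X ⊆ Z ∩ box d m → ∀ Y : Finset (Site d), Y ⊆ Z \ box d (τ m) →
        ϰ * (bondPercolation (zdGraph d) p).real {ω | ∃ x ∈ X, ∃ s ∈ innerBoundary (zdGraph d) (box d (σ m)),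
              ω ∈ openConnIn (↑Z : Set (Site d)) x s} *
          (bondPercolation (zdGraph d) p).real {ω | ∃ y ∈ Y, ∃ s ∈ innerBoundary (zdGraph d) (box d (σ m)),
              ω ∈ openConnIn (↑Z : Set (Site d)) y s} ≤
        (bondPercolation (zdGraph d) p).real {ω | ∃ x ∈ X, ∃ y ∈ Y, ω ∈ openConnIn (↑Z : Set (Site d)) x y})
    {L : ℕ} (hL : 1 ≤ L) {M1 M2 μ1 μ2 : ℕ → ℕ}
    {n : ℕ} (hM : ∀ l ≤ L, 1 ≤ M1 l ∧ M1 l ≤ M2 l ∧ τ (M1 l) < σ (M2 l) ∧ τ (M2 l) + 1 ≤ n)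
    {W T W' T' : Finset (Site d)} (hW : box d n ⊆ W) (hTW : T ⊆ W) (hTn : ∀ t ∈ T, t ∉ box d (n - 1))
    (hTr : ∀ s ∈ innerBoundary (zdGraph d) (box d n), ∃ t ∈ T, ∃ q : (zdGraph d).Walk s t,
      ∀ z ∈ q.support, z ∈ (↑W : Set (Site d)) \ ↑(box d (n - 1)))
    (hW' : box d n ⊆ W') (hTW' : T' ⊆ W') (hTn' : ∀ t ∈ T', t ∉ box d (n - 1))
    (hTr' : ∀ s ∈ innerBoundary (zdGraph d) (box d n), ∃ t ∈ T', ∃ q : (zdGraph d).Walk s t,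
      ∀ z ∈ q.support, z ∈ (↑W' : Set (Site d)) \ ↑(box d (n - 1)))
    (hμ : ∀ l < L, τ (σ (M2 (l + 1)) + 1) + 2 ≤ σ (μ1 l) ∧ τ (μ1 l) < σ (μ2 l) ∧ μ2 l ≤ M1 l)
    (hjunk : ∀ l < L, (bondPercolation (zdGraph d) p).real (boxCrossing d (σ (μ1 l)) (σ (μ2 l))) +
      (bondPercolation (zdGraph d) p).real (boxCrossing d (σ (M1 l)) (σ (M2 l))) ≤ ϰ ^ 2 * ε)
    (hε0 : 0 ≤ ε) (hε1 : ε < 1) (Q : ℕ → ℝ) (hQ1 : (1 / ϰ ^ 2) / (1 - ε) ^ 2 ≤ Q 1)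
    (hQ : ∀ l : ℕ, 1 ≤ l → (1 / (1 / ϰ ^ 2) + (1 - 1 / (1 / ϰ ^ 2)) * Q l) / (1 - ε) ^ 2 ≤ Q (l + 1))
    {C C' : Finset (Site d) × Finset (Site d)} (hC : C ∈ ((box d (σ (M2 L))).powerset.filter (fun U => box d (σ (M1 L)) ⊆ U)) ×ˢ (box d (σ (M2 L) + 1)).powerset)
    (hC' : C' ∈ ((box d (σ (M2 L))).powerset.filter (fun U => box d (σ (M1 L)) ⊆ U)) ×ˢ (box d (σ (M2 L) + 1)).powerset)
    (hCγ : 0 < (bondPercolation (zdGraph d) p).real {ω : BondConfig (Site d) | ∃ x ∈ C.2, ∃ t ∈ innerBoundary (zdGraph d) (box d n),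
            ω ∈ openConnIn ((↑(box d n) : Set (Site d)) \ ↑C.1) x t})
    (hCD : 0 < (bondPercolation (zdGraph d) p).real {ω : BondConfig (Site d) | ω ∩ (↑((box d (σ (M2 L) + 1)).sym2) : Set (Sym2 (Site d))) ∈
            explEvent (↑(box d (σ (M1 L))) : Set (Site d)) ((↑(box d (σ (M2 L))) : Set (Site d)) \ ↑(box d (σ (M1 L)))) ↑C.1 ↑C.2})
    (hC'γ : 0 < (bondPercolation (zdGraph d) p).real {ω : BondConfig (Site d) | ∃ x ∈ C'.2, ∃ t ∈ innerBoundary (zdGraph d) (box d n),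
            ω ∈ openConnIn ((↑(box d n) : Set (Site d)) \ ↑C'.1) x t})
    (hC'D : 0 < (bondPercolation (zdGraph d) p).real {ω : BondConfig (Site d) | ω ∩ (↑((box d (σ (M2 L) + 1)).sym2) : Set (Sym2 (Site d))) ∈
            explEvent (↑(box d (σ (M1 L))) : Set (Site d)) ((↑(box d (σ (M2 L))) : Set (Site d)) \ ↑(box d (σ (M1 L)))) ↑C'.1 ↑C'.2}) :
    (bondPercolation (zdGraph d) p).real {ω : BondConfig (Site d) | ∃ x ∈ C.2, ∃ t ∈ T,
            ω ∈ openConnIn ((↑W : Set (Site d)) \ ↑C.1) x t} *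
      (bondPercolation (zdGraph d) p).real {ω : BondConfig (Site d) | ∃ x ∈ C'.2, ∃ t ∈ T',
            ω ∈ openConnIn ((↑W' : Set (Site d)) \ ↑C'.1) x t} ≤
      Q L * ((bondPercolation (zdGraph d) p).real {ω : BondConfig (Site d) | ∃ x ∈ C'.2, ∃ t ∈ T,
            ω ∈ openConnIn ((↑W : Set (Site d)) \ ↑C'.1) x t} *
        (bondPercolation (zdGraph d) p).real {ω : BondConfig (Site d) | ∃ x ∈ C.2, ∃ t ∈ T',
            ω ∈ openConnIn ((↑W' : Set (Site d)) \ ↑C.1) x t}) := by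
  classical
  -- the scheme data
  set 𝒮 : ℕ → Finset (Finset (Site d) × Finset (Site d)) := fun l =>
    ((((box d (σ (M2 l))).powerset.filter (fun U => box d (σ (M1 l)) ⊆ U)) ×ˢ (box d (σ (M2 l) + 1)).powerset).filter (fun D =>
          0 < (bondPercolation (zdGraph d) p).real {ω : BondConfig (Site d) | ∃ x ∈ D.2, ∃ t ∈ innerBoundary (zdGraph d) (box d n),
            ω ∈ openConnIn ((↑(box d n) : Set (Site d)) \ ↑D.1) x t} ∧
          0 < (bondPercolation (zdGraph d) p).real {ω : BondConfig (Site d) | ω ∩ (↑((box d (σ (M2 l) + 1)).sym2) : Set (Sym2 (Site d))) ∈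
            explEvent (↑(box d (σ (M1 l))) : Set (Site d)) ((↑(box d (σ (M2 l))) : Set (Site d)) \ ↑(box d (σ (M1 l)))) ↑D.1 ↑D.2} ∧
          (L ≤ l ∨ 0 < (∑ I ∈ (box d (σ (μ2 l) - 1) \ box d (σ (μ1 l) - 1)).powerset ×ˢ (innerBoundary (zdGraph d) (box d (σ (μ1 l) - 1))).powerset,
        (bondPercolation (zdGraph d) p).real {ω : BondConfig (Site d) | ∃ y ∈ I.2, ∃ w ∈ innerBoundary (zdGraph d) (box d (σ (σ (M2 (l + 1)) + 1))),
          ω ∈ openConnIn ((↑(box d (σ (μ2 l))) : Set (Site d)) \ (↑(I.1 ∪ innerBoundary (zdGraph d) (box d (σ (μ2 l)))) ∪ ↑(box d (σ (σ (M2 (l + 1)) + 1) - 1)))) y w} *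
        (bondPercolation (zdGraph d) p).real
          ({ω : BondConfig (Site d) | ω ∩ (↑((box d (σ (μ2 l))).sym2) : Set (Sym2 (Site d))) ∈
                explEvent ((↑(box d (σ (μ2 l) - 1)) : Set (Site d))ᶜ) ((↑(box d (σ (μ2 l) - 1)) : Set (Site d)) \ ↑(box d (σ (μ1 l) - 1)))
                  ((↑(box d (σ (μ2 l) - 1)) : Set (Site d))ᶜ ∪ ↑I.1) ↑I.2} ∩
           {ω : BondConfig (Site d) | ∀ y ∈ I.2, ∀ y' ∈ I.2, ∀ z ∈ I.1 ∪ innerBoundary (zdGraph d) (box d (σ (μ2 l))),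
                ∀ z' ∈ I.1 ∪ innerBoundary (zdGraph d) (box d (σ (μ2 l))), s(z, y) ∈ ω → s(z', y') ∈ ω →
                ω ∈ openConnIn (↑(I.1 ∪ innerBoundary (zdGraph d) (box d (σ (μ2 l)))) : Set (Site d)) z z'} ∩
           {ω : BondConfig (Site d) | ∃ y ∈ I.2, ∃ z ∈ I.1 ∪ innerBoundary (zdGraph d) (box d (σ (μ2 l))), s(z, y) ∈ ω ∧
            ∃ r ∈ D.2, ∃ v ∈ D.1, ω ∈ openConnIn ((↑(I.1 ∪ innerBoundary (zdGraph d) (box d (σ (μ2 l)))) : Set (Site d)) ∪ (↑D.1 \ ↑(box d (σ (μ2 l))))) z v ∧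
              s(v, r) ∈ ω} ∩
           {ω : BondConfig (Site d) | ω ∩ (↑((box d (σ (M2 l) + 1)).sym2) : Set (Sym2 (Site d))) ∈
            explEvent (↑(box d (σ (M1 l))) : Set (Site d)) ((↑(box d (σ (M2 l))) : Set (Site d)) \ ↑(box d (σ (M1 l)))) ↑D.1 ↑D.2} ∩
           {ω : BondConfig (Site d) | ∀ r ∈ D.2, ∀ r' ∈ D.2, ∃ v ∈ D.1, ∃ v' ∈ D.1,
            s(v, r) ∈ ω ∧ s(v', r') ∈ ω ∧ ω ∈ openConnIn ((↑D.1 : Set (Site d)) \ ↑(box d (σ (M1 l) - 1))) v v'}))))) with h𝒮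
  set Kf : ℕ → Finset (Site d) × Finset (Site d) → Finset (Site d) × Finset (Site d) → ℝ := fun l C D =>
    (bondPercolation (zdGraph d) p).real
        ((⋃ I ∈ (box d (σ (μ2 l) - 1) \ box d (σ (μ1 l) - 1)).powerset ×ˢ (innerBoundary (zdGraph d) (box d (σ (μ1 l) - 1))).powerset,
            ({ω : BondConfig (Site d) | ω ∩ (↑((box d (σ (μ2 l))).sym2) : Set (Sym2 (Site d))) ∈
                explEvent ((↑(box d (σ (μ2 l) - 1)) : Set (Site d))ᶜ) ((↑(box d (σ (μ2 l) - 1)) : Set (Site d)) \ ↑(box d (σ (μ1 l) - 1)))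
                  ((↑(box d (σ (μ2 l) - 1)) : Set (Site d))ᶜ ∪ ↑I.1) ↑I.2} ∩
             {ω : BondConfig (Site d) | ∀ y ∈ I.2, ∀ y' ∈ I.2, ∀ z ∈ I.1 ∪ innerBoundary (zdGraph d) (box d (σ (μ2 l))),
                ∀ z' ∈ I.1 ∪ innerBoundary (zdGraph d) (box d (σ (μ2 l))), s(z, y) ∈ ω → s(z', y') ∈ ω →
                ω ∈ openConnIn (↑(I.1 ∪ innerBoundary (zdGraph d) (box d (σ (μ2 l)))) : Set (Site d)) z z'})) ∩
          ({ω : BondConfig (Site d) | ∃ x ∈ C.2, ∃ r ∈ D.2, ∃ v ∈ D.1, ω ∈ openConnIn ((↑D.1 : Set (Site d)) \ ↑C.1) x v ∧ s(v, r) ∈ ω} ∩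
           {ω : BondConfig (Site d) | ω ∩ (↑((box d (σ (M2 l) + 1)).sym2) : Set (Sym2 (Site d))) ∈
            explEvent (↑(box d (σ (M1 l))) : Set (Site d)) ((↑(box d (σ (M2 l))) : Set (Site d)) \ ↑(box d (σ (M1 l)))) ↑D.1 ↑D.2} ∩
           {ω : BondConfig (Site d) | ∀ r ∈ D.2, ∀ r' ∈ D.2, ∃ v ∈ D.1, ∃ v' ∈ D.1,
            s(v, r) ∈ ω ∧ s(v', r') ∈ ω ∧ ω ∈ openConnIn ((↑D.1 : Set (Site d)) \ ↑(box d (σ (M1 l) - 1))) v v'})) with hKf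
  set γb : Finset (Site d) × Finset (Site d) → ℝ := fun D =>
    (bondPercolation (zdGraph d) p).real {ω : BondConfig (Site d) | ∃ x ∈ D.2, ∃ t ∈ innerBoundary (zdGraph d) (box d n),
            ω ∈ openConnIn ((↑(box d n) : Set (Site d)) \ ↑D.1) x t} with hγb
  set γf : Finset (Site d) → Finset (Site d) → Finset (Site d) × Finset (Site d) → ℝ := fun W₁ T₁ D =>
    (bondPercolation (zdGraph d) p).real {ω : BondConfig (Site d) | ∃ x ∈ D.2, ∃ t ∈ T₁,
            ω ∈ openConnIn ((↑W₁ : Set (Site d)) \ ↑D.1) x t} with hγf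
  -- arithmetic of the scales at level `l < L`
  have lev : ∀ l < L, σ (σ (M2 (l + 1)) + 1) ≤ n ∧ σ (μ1 l) - 1 + 2 ≤ σ (μ2 l) ∧ σ (μ2 l) ≤ σ (M1 l) ∧
      σ (M1 l) ≤ σ (M2 l) ∧ τ (M2 l) + 1 ≤ n := by
    intro l hl
    obtain ⟨h1, h2, h3⟩ := hμ l hl
    obtain ⟨h4, h45, h5, h6⟩ := hM l hl.le
    obtain ⟨h4', h45', -, -⟩ := hM (l + 1) hl
    have a4 := hσ (M2 (l + 1)) (by omega)
    have a5 := hσ (σ (M2 (l + 1)) + 1) (by omega)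
    have a6 := hστ (σ (M2 (l + 1)) + 1) (by omega)
    have a7 : σ (M2 (l + 1)) + 1 < μ1 l := hσm.reflect_lt (by omega)
    have a8 := hστ (μ1 l) (by omega)
    have a10 : σ (μ2 l) ≤ σ (M1 l) := hσm h3
    have a12 := hστ (M1 l) h4
    have a13 : σ (M1 l) ≤ σ (M2 l) := hσm h45
    have a14 := hστ (M2 l) (by omega)
    exact ⟨by omega, by omega, a10, a13, by omega⟩
  have hK : (1 : ℝ) ≤ 1 / ϰ ^ 2 := by
    rw [le_div_iff₀ (by positivity), one_mul]
    exact pow_le_one₀ hϰ.le hϰ1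
  -- membership facts
  have facts : ∀ l ≤ L, ∀ D ∈ 𝒮 l,
      (D.1 ⊆ box d (σ (M2 l)) ∧ box d (σ (M1 l)) ⊆ D.1 ∧ D.2 ⊆ box d (σ (M2 l) + 1)) ∧ 0 < γb D ∧
      0 < (bondPercolation (zdGraph d) p).real {ω : BondConfig (Site d) | ω ∩ (↑((box d (σ (M2 l) + 1)).sym2) : Set (Sym2 (Site d))) ∈
            explEvent (↑(box d (σ (M1 l))) : Set (Site d)) ((↑(box d (σ (M2 l))) : Set (Site d)) \ ↑(box d (σ (M1 l)))) ↑D.1 ↑D.2} ∧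
      (L ≤ l ∨ 0 < (∑ I ∈ (box d (σ (μ2 l) - 1) \ box d (σ (μ1 l) - 1)).powerset ×ˢ (innerBoundary (zdGraph d) (box d (σ (μ1 l) - 1))).powerset,
        (bondPercolation (zdGraph d) p).real {ω : BondConfig (Site d) | ∃ y ∈ I.2, ∃ w ∈ innerBoundary (zdGraph d) (box d (σ (σ (M2 (l + 1)) + 1))),
          ω ∈ openConnIn ((↑(box d (σ (μ2 l))) : Set (Site d)) \ (↑(I.1 ∪ innerBoundary (zdGraph d) (box d (σ (μ2 l)))) ∪ ↑(box d (σ (σ (M2 (l + 1)) + 1) - 1)))) y w} *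
        (bondPercolation (zdGraph d) p).real
          ({ω : BondConfig (Site d) | ω ∩ (↑((box d (σ (μ2 l))).sym2) : Set (Sym2 (Site d))) ∈
                explEvent ((↑(box d (σ (μ2 l) - 1)) : Set (Site d))ᶜ) ((↑(box d (σ (μ2 l) - 1)) : Set (Site d)) \ ↑(box d (σ (μ1 l) - 1)))
                  ((↑(box d (σ (μ2 l) - 1)) : Set (Site d))ᶜ ∪ ↑I.1) ↑I.2} ∩
           {ω : BondConfig (Site d) | ∀ y ∈ I.2, ∀ y' ∈ I.2, ∀ z ∈ I.1 ∪ innerBoundary (zdGraph d) (box d (σ (μ2 l))),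
                ∀ z' ∈ I.1 ∪ innerBoundary (zdGraph d) (box d (σ (μ2 l))), s(z, y) ∈ ω → s(z', y') ∈ ω →
                ω ∈ openConnIn (↑(I.1 ∪ innerBoundary (zdGraph d) (box d (σ (μ2 l)))) : Set (Site d)) z z'} ∩
           {ω : BondConfig (Site d) | ∃ y ∈ I.2, ∃ z ∈ I.1 ∪ innerBoundary (zdGraph d) (box d (σ (μ2 l))), s(z, y) ∈ ω ∧
            ∃ r ∈ D.2, ∃ v ∈ D.1, ω ∈ openConnIn ((↑(I.1 ∪ innerBoundary (zdGraph d) (box d (σ (μ2 l)))) : Set (Site d)) ∪ (↑D.1 \ ↑(box d (σ (μ2 l))))) z v ∧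
              s(v, r) ∈ ω} ∩
           {ω : BondConfig (Site d) | ω ∩ (↑((box d (σ (M2 l) + 1)).sym2) : Set (Sym2 (Site d))) ∈
            explEvent (↑(box d (σ (M1 l))) : Set (Site d)) ((↑(box d (σ (M2 l))) : Set (Site d)) \ ↑(box d (σ (M1 l)))) ↑D.1 ↑D.2} ∩
           {ω : BondConfig (Site d) | ∀ r ∈ D.2, ∀ r' ∈ D.2, ∃ v ∈ D.1, ∃ v' ∈ D.1,
            s(v, r) ∈ ω ∧ s(v', r') ∈ ω ∧ ω ∈ openConnIn ((↑D.1 : Set (Site d)) \ ↑(box d (σ (M1 l) - 1))) v v'}))) ∧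
      (∀ r ∈ D.2, r ∉ box d (σ (M2 l))) ∧ (∀ r ∈ D.2, r ∉ D.1) := by
    intro l hl D hD
    simp only [h𝒮, Finset.mem_filter, Finset.mem_product, Finset.mem_powerset] at hD
    obtain ⟨⟨⟨hUb, hUa⟩, hR⟩, hγ, hdat, hβ⟩ := hD
    have hMl := hσm (hM l hl).2.1
    exact ⟨⟨hUb, hUa, hR⟩, hγ, hdat, hβ, fun r hr hrb => hdat.ne' (real_dat_eq_zero_of_mem_box p hMl hUb hr hrb),
      fun r hr hrU => hdat.ne' (real_dat_eq_zero_of_mem_left p hMl hUb hr hrU)⟩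
  have hCs : C ∈ 𝒮 L := by
    simp only [h𝒮, Finset.mem_filter]; exact ⟨hC, hCγ, hCD, Or.inl le_rfl⟩
  have hC's : C' ∈ 𝒮 L := by
    simp only [h𝒮, Finset.mem_filter]; exact ⟨hC', hC'γ, hC'D, Or.inl le_rfl⟩
  -- positivity for the two admissible targets
  have hposT : ∀ l ≤ L, ∀ D ∈ 𝒮 l, 0 < γf W T D ∧ 0 < γf W' T' D := by
    intro l hl D hD
    obtain ⟨⟨hUb, -, -⟩, hγ, -⟩ := facts l hl D hD
    obtain ⟨h4, h45, -, h6⟩ := hM l hl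
    have a14 := hστ (M2 l) (by omega)
    exact ⟨real_conn_target_pos_of_real_conn_pos p hp (b := σ (M2 l)) (by omega) hUb hW hTr hγ,
      real_conn_target_pos_of_real_conn_pos p hp (b := σ (M2 l)) (by omega) hUb hW' hTr' hγ⟩
  -- hypothesis hU / hU' at level `l < L`, for an admissible target
  have hUN : ∀ W₁ T₁ : Finset (Site d), box d n ⊆ W₁ → T₁ ⊆ W₁ → (∀ t ∈ T₁, t ∉ box d (n - 1)) → ∀ l < L, ∀ C ∈ 𝒮 (l + 1),
      ∑ D ∈ 𝒮 l, Kf l C D * γf W₁ T₁ D ≤ γf W₁ T₁ C ∧ (1 - ε) * γf W₁ T₁ C ≤ ∑ D ∈ 𝒮 l, Kf l C D * γf W₁ T₁ D := by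
    intro W₁ T₁ hW₁ hTW₁ hTn₁ l hl C hC
    obtain ⟨⟨hH, -, hX⟩, -, -, -, -, hXH⟩ := facts (l + 1) (by omega) C hC
    obtain ⟨h1, h2, h3⟩ := hμ l hl
    obtain ⟨-, -, h5, h6⟩ := hM l (by omega)
    have hfl : 𝒮 l = ((((box d (σ (M2 l))).powerset.filter (fun U => box d (σ (M1 l)) ⊆ U)) ×ˢ (box d (σ (M2 l) + 1)).powerset).filter (fun D =>
          0 < (bondPercolation (zdGraph d) p).real {ω : BondConfig (Site d) | ∃ x ∈ D.2, ∃ t ∈ innerBoundary (zdGraph d) (box d n),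
            ω ∈ openConnIn ((↑(box d n) : Set (Site d)) \ ↑D.1) x t} ∧
          0 < (bondPercolation (zdGraph d) p).real {ω : BondConfig (Site d) | ω ∩ (↑((box d (σ (M2 l) + 1)).sym2) : Set (Sym2 (Site d))) ∈
            explEvent (↑(box d (σ (M1 l))) : Set (Site d)) ((↑(box d (σ (M2 l))) : Set (Site d)) \ ↑(box d (σ (M1 l)))) ↑D.1 ↑D.2} ∧
          0 < (∑ I ∈ (box d (σ (μ2 l) - 1) \ box d (σ (μ1 l) - 1)).powerset ×ˢ (innerBoundary (zdGraph d) (box d (σ (μ1 l) - 1))).powerset,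
        (bondPercolation (zdGraph d) p).real {ω : BondConfig (Site d) | ∃ y ∈ I.2, ∃ w ∈ innerBoundary (zdGraph d) (box d (σ (σ (M2 (l + 1)) + 1))),
          ω ∈ openConnIn ((↑(box d (σ (μ2 l))) : Set (Site d)) \ (↑(I.1 ∪ innerBoundary (zdGraph d) (box d (σ (μ2 l)))) ∪ ↑(box d (σ (σ (M2 (l + 1)) + 1) - 1)))) y w} *
        (bondPercolation (zdGraph d) p).real
          ({ω : BondConfig (Site d) | ω ∩ (↑((box d (σ (μ2 l))).sym2) : Set (Sym2 (Site d))) ∈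
                explEvent ((↑(box d (σ (μ2 l) - 1)) : Set (Site d))ᶜ) ((↑(box d (σ (μ2 l) - 1)) : Set (Site d)) \ ↑(box d (σ (μ1 l) - 1)))
                  ((↑(box d (σ (μ2 l) - 1)) : Set (Site d))ᶜ ∪ ↑I.1) ↑I.2} ∩
           {ω : BondConfig (Site d) | ∀ y ∈ I.2, ∀ y' ∈ I.2, ∀ z ∈ I.1 ∪ innerBoundary (zdGraph d) (box d (σ (μ2 l))),
                ∀ z' ∈ I.1 ∪ innerBoundary (zdGraph d) (box d (σ (μ2 l))), s(z, y) ∈ ω → s(z', y') ∈ ω →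
                ω ∈ openConnIn (↑(I.1 ∪ innerBoundary (zdGraph d) (box d (σ (μ2 l)))) : Set (Site d)) z z'} ∩
           {ω : BondConfig (Site d) | ∃ y ∈ I.2, ∃ z ∈ I.1 ∪ innerBoundary (zdGraph d) (box d (σ (μ2 l))), s(z, y) ∈ ω ∧
            ∃ r ∈ D.2, ∃ v ∈ D.1, ω ∈ openConnIn ((↑(I.1 ∪ innerBoundary (zdGraph d) (box d (σ (μ2 l)))) : Set (Site d)) ∪ (↑D.1 \ ↑(box d (σ (μ2 l))))) z v ∧
              s(v, r) ∈ ω} ∩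
           {ω : BondConfig (Site d) | ω ∩ (↑((box d (σ (M2 l) + 1)).sym2) : Set (Sym2 (Site d))) ∈
            explEvent (↑(box d (σ (M1 l))) : Set (Site d)) ((↑(box d (σ (M2 l))) : Set (Site d)) \ ↑(box d (σ (M1 l)))) ↑D.1 ↑D.2} ∩
           {ω : BondConfig (Site d) | ∀ r ∈ D.2, ∀ r' ∈ D.2, ∃ v ∈ D.1, ∃ v' ∈ D.1,
            s(v, r) ∈ ω ∧ s(v', r') ∈ ω ∧ ω ∈ openConnIn ((↑D.1 : Set (Site d)) \ ↑(box d (σ (M1 l) - 1))) v v'})))) := by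
      simp only [h𝒮]
      refine Finset.filter_congr fun D _ => ?_
      simp only [show ¬ (L ≤ l) from by omega, false_or]
    rw [hfl]
    have h := scheme_sum_two_sided_target p hϰ hσ hστ hσm hτm hA2 (mm := M2 (l + 1)) (n := n) h1 h2 h3 h5 h6 hW₁ hTW₁ hTn₁
      (hjunk l hl) hH hX hXH
    exact ⟨h.2, h.1⟩
  -- the hypotheses of `kesten_multilevel_osc_le`
  have hne : ∀ l ≤ L, (𝒮 l).Nonempty := by
    have key : ∀ k : ℕ, k ≤ L → (𝒮 (L - k)).Nonempty := by
      intro k hk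
      induction k with
      | zero => exact ⟨C, hCs⟩
      | succ k ih =>
        obtain ⟨C₁, hC₁⟩ := ih (by omega)
        have hl : L - (k + 1) < L := by omega
        have hl1 : L - (k + 1) + 1 = L - k := by omega
        have hC₁' : C₁ ∈ 𝒮 (L - (k + 1) + 1) := by rw [hl1]; exact hC₁
        have hb := (hUN W T hW hTW hTn (L - (k + 1)) hl C₁ hC₁').2
        have hγ₁ := (hposT (L - (k + 1) + 1) (by omega) C₁ hC₁').1
        by_contra hemp
        rw [Finset.not_nonempty_iff_eq_empty] at hemp
        rw [hemp, Finset.sum_empty] at hb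
        have : 0 < (1 - ε) * γf W T C₁ := mul_pos (by linarith) hγ₁
        linarith
    intro l hl
    have := key (L - l) (by omega)
    rwa [show L - (L - l) = l from by omega] at this
  have hMpos : ∀ l < L, ∀ C ∈ 𝒮 (l + 1), ∀ D ∈ 𝒮 l, 0 < Kf l C D := by
    intro l hl C hC D hD
    obtain ⟨⟨hH, -, hX⟩, hγC, -, -, -, hXH⟩ := facts (l + 1) (by omega) C hC
    obtain ⟨⟨hUb, hUa, hR⟩, -, -, hβ, hRb, -⟩ := facts l (by omega) D hD
    obtain ⟨h1, h2, h3⟩ := hμ l hl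
    obtain ⟨-, h45, -, -⟩ := hM l (by omega)
    exact kernel_pos_aspect p hϰ hσ hστ hσm hA2 (mm := M2 (l + 1)) (n := n) h1 h2 h3 h45 (lev l hl).1 hH hX hXH
      hUa hUb hR hRb hγC (hβ.resolve_left (by omega))
  have hcross : ∀ l < L, ∀ C ∈ 𝒮 (l + 1), ∀ C' ∈ 𝒮 (l + 1), ∀ D ∈ 𝒮 l, ∀ D' ∈ 𝒮 l,
      Kf l C D * Kf l C' D' ≤ 1 / ϰ ^ 2 * (Kf l C D' * Kf l C' D) := by
    intro l hl C hC C' hC' D hD D' hD'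
    obtain ⟨⟨hH, -, hX⟩, -, -, -, -, hXH⟩ := facts (l + 1) (by omega) C hC
    obtain ⟨⟨hH', -, hX'⟩, -, -, -, -, hXH'⟩ := facts (l + 1) (by omega) C' hC'
    obtain ⟨⟨hUb, hUa, hR⟩, -, -, -, hRb, -⟩ := facts l (by omega) D hD
    obtain ⟨⟨hUb', hUa', hR'⟩, -, -, -, hRb', -⟩ := facts l (by omega) D' hD'
    obtain ⟨h1, h2, h3⟩ := hμ l hl
    obtain ⟨-, hB, hC3, hD, -⟩ := lev l hl
    have hHm : C.1 ⊆ box d (σ (M2 (l + 1)) + 1 - 1) := by rw [Nat.add_sub_cancel]; exact hH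
    have hHm' : C'.1 ⊆ box d (σ (M2 (l + 1)) + 1 - 1) := by rw [Nat.add_sub_cancel]; exact hH'
    have h : ϰ ^ 2 * (Kf l C D * Kf l C' D') ≤ Kf l C D' * Kf l C' D :=
      kernel_crossRatio_le_aspect p hϰ.le hσ hστ hA2 (m := σ (M2 (l + 1)) + 1) (c := σ (μ1 l) - 1) (s := σ (μ2 l)) (a := σ (M1 l))
        (b := σ (M2 l)) (by omega) (by omega) hB hC3 hD hHm hX hXH hHm' hX' hXH' hUa hUb hR hRb hUa' hUb' hR' hRb'
    rw [one_div]
    exact (le_inv_mul_iff₀ (by positivity)).2 h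
  have hU0 : ∀ D ∈ 𝒮 0, 0 < γf W T D := fun D hD => (hposT 0 (by omega) D hD).1
  have hU0' : ∀ D ∈ 𝒮 0, 0 < γf W' T' D := fun D hD => (hposT 0 (by omega) D hD).2
  have osc := kesten_multilevel_osc_le 𝒮 Kf (fun _ D => γf W T D) (fun _ D => γf W' T' D) Q L hK hε0 hε1 hne hMpos hcross hU0 hU0'
    (fun l hl C hC => hUN W T hW hTW hTn l hl C hC) (fun l hl C hC => hUN W' T' hW' hTW' hTn' l hl C hC) hQ1 (fun l hl _ => hQ l hl)
    L hL le_rfl C hCs C' hC's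
  -- unpack the double ratio
  have h1 : 0 < γf W' T' C := (hposT L le_rfl C hCs).2
  have h2 : 0 < γf W T C' := (hposT L le_rfl C' hC's).1
  change γf W T C / γf W' T' C / (γf W T C' / γf W' T' C') ≤ Q L at osc
  change γf W T C * γf W' T' C' ≤ Q L * (γf W T C' * γf W' T' C)
  rw [div_div_div_eq, div_le_iff₀ (mul_pos h1 h2)] at osc
  linarith [mul_comm (γf W T C') (γf W' T' C)]


end Summit.CriticalPhenomena.PercolationContinuityZ3.Theorems.Crossing

end
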